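import Literature.Combinatorics.HalesJewett.DKTSubspaces
import HarnessLib

/-!
# Density Hales–Jewett: correlation with insensitive sets (DKT Lemmas 7, 8, 10, Corollary 11)

Topic `Literature/Combinatorics/HalesJewett`. P. Dodos, V. Kanellopoulos, K. Tyros, *A simple
proof of the density Hales–Jewett theorem*, IMRN 2014 (= arXiv:1209.4986), §4.1, first half:
assuming `DHJ α` (through a witness `m₀` at density `δ/4`) and the Graham–Rothschild fact
`GrahamRothschildLines`, a dense line-free `A ⊆ (Option α)^ι` either has a density increment on an
`m`-dimensional subspace or correlates with an intersection `D = ⋂ᵢ Dᵢ` of `(i,∗)`-insensitive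
sets inside some `m`-dimensional subspace `W` (all PROVED):

* `dkt_lemma7` (Lemma 7: a subspace `U` with dense fibres and, for every line `ℓ` of `U ↾ k`,
  `dens(⋂_{u ∈ ℓ} A_u) ≥ θ`; uses `uniformization`, Graham–Rothschild, `DHJ α` and a pigeonhole over
  the `(k+1)^{m₀} - k^{m₀}` lines of `α^{m₀}`);
* `dkt_lemma8` (Lemma 8: the dichotomy increment / many lines of `W ↾ k` inside `A`);
* `Insensitive` (Def. 9, in the `Option` encoding: membership depends only on the word read with
  `∗ ↦ i`), `dkt_lemma10` (Lemma 10), `dkt_cor11` (Corollary 11).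

Constants: `θ = (δ/4)/((k+1)^{m₀} - k^{m₀})`, `η = δθ/48` (entering through the hypotheses
`48η ≤ δθ`, `η < θ/2`, …), `γ = δη²/(2k)` (DKT: `δη²/k`, `k ≥ 2`; the factor `2` lets `k ≥ 1`).

## References
* P. Dodos, V. Kanellopoulos, K. Tyros, IMRN 2014, Def. 9, Lemmas 7, 8, 10, Cor. 11. [cite: DodosKanellopoulosTyros2014]
-/

open Combinatorics Finset

namespace Literature.Combinatorics.HalesJewett



/-! ### Lines as words: evaluation; associativity of composition -/

/-- Evaluation of a word over `Option α` at a letter: substitute `a` for the wildcards. For the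
word `ℓ.idxFun` of a line this is `ℓ a`. [folklore] -/
def wordLine {α η : Type*} (w : η → Option α) (a : α) : η → α := fun i => (w i).getD a

/-- `ℓ a = wordLine ℓ.idxFun a`. [folklore] -/
theorem line_apply_eq_wordLine {α η : Type*} (l : Line α η) (a : α) :
    ⇑l a = wordLine l.idxFun a := rfl

/-- Associativity: the line `ℓ` pushed through `W` and then `V` is `ℓ` pushed through `V ∘ W`.
[folklore] -/
theorem Subspace.comp_line {η η' α ι : Type*} (V : Subspace η α ι) (W : Subspace η' α η)
    (l : Line α η') :
    Subspace.line (Subspace.comp V W) l = Subspace.line V (Subspace.line W l) := by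
  ext i : 2
  simp only [Subspace.line_idxFun_apply, Subspace.comp]
  cases V.idxFun i <;> rfl

/-- The subspace of `α^{Fin m}` spanned by the first `m₀ ≤ m` directions, the remaining
coordinates frozen to `a₀`. [folklore] -/
def Subspace.first {α : Type*} (m₀ m : ℕ) (h : m₀ ≤ m) (a₀ : α) : Subspace (Fin m₀) α (Fin m) where
  idxFun i := if hi : (i : ℕ) < m₀ then Sum.inr ⟨i, hi⟩ else Sum.inl a₀
  proper e := ⟨⟨e, lt_of_lt_of_le e.isLt h⟩, by simp⟩

/-! ### DKT Lemma 7 -/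

/-- The number of lines of `α^{m₀}` as a real number, `(k+1)^{m₀} - k^{m₀}`. [folklore] -/
theorem card_lineWords_real (α : Type*) [Fintype α] [DecidableEq α] (m₀ : ℕ) :
    (#(lineWords α (Fin m₀)) : ℝ) = ((Fintype.card α : ℝ) + 1) ^ m₀ - (Fintype.card α : ℝ) ^ m₀ := by
  rw [card_lineWords, Fintype.card_fin, Nat.cast_sub (Nat.pow_le_pow_left (Nat.le_succ _) _)]
  push_cast; ring

/-- For `m₀ ≥ 1` there is at least one line of `α^{m₀}`. [folklore] -/
theorem lineWords_nonempty (α : Type*) [Fintype α] [DecidableEq α] {m₀ : ℕ} (hm₀ : 1 ≤ m₀) :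
    (lineWords α (Fin m₀)).Nonempty :=
  ⟨fun _ => none, mem_lineWords.2 ⟨⟨0, hm₀⟩, rfl⟩⟩

/-- **DKT Lemma 7.** Assume `DHJ α` with witness `m₀ ≥ 1` at density `δ/4` (i.e. every subset of
`α^ι`, `|ι| ≥ m₀`, of density `≥ δ/4` contains a line), the Graham–Rothschild fact, `k = |α| ≥ 2`,
`m ≥ m₀`, `0 < ε' ≤ δ/2`, and let `θ = (δ/4)/((k+1)^{m₀} - k^{m₀})`. Then for all large `ι`, every
`A ⊆ (Option α)^ι` of density `≥ δ` admits a splitting `ι ≃ β ⊕ γ` and an `m`-dimensional subspace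
`U` of `(Option α)^β` with (a) `rdens A_u ≥ δ - ε'` for every `u ∈ U` and (b)
`rdens (⋂_{a} A_{U(ℓ(a))}) ≥ θ` for every line `ℓ` of `U ↾ k`.
[cite: DodosKanellopoulosTyros2014, Lemma 7] -/
theorem dkt_lemma7 {α : Type} [Fintype α] [DecidableEq α] (hk : 1 ≤ Fintype.card α)
    (hGR : GrahamRothschildLines) {δ : ℝ} (hδ : 0 < δ) {m₀ : ℕ} (hm₀ : 1 ≤ m₀)
    (hDHJ : ∀ (ι : Type) [Fintype ι] [DecidableEq ι], m₀ ≤ Fintype.card ι →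
      ∀ B : Finset (ι → α), δ / 4 ≤ rdens B → ∃ l : Line α ι, ∀ a, l a ∈ B)
    {m : ℕ} (hm : m₀ ≤ m) {ε' : ℝ} (hε' : 0 < ε') (hε'δ : ε' ≤ δ / 2) :
    ∃ N : ℕ, ∀ (ι : Type) [Fintype ι] [DecidableEq ι], N ≤ Fintype.card ι →
      ∀ A : Finset (ι → Option α), δ ≤ rdens A →
        ∃ (β γ : Type) (_ : Fintype β) (_ : DecidableEq β) (_ : Fintype γ) (_ : DecidableEq γ)
          (e : ι ≃ β ⊕ γ) (U : Subspace (Fin m) (Option α) β),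
          (∀ u : Fin m → Option α, δ - ε' ≤ rdens (fiber (transport e A) (U u))) ∧
          (∀ w ∈ lineWords α (Fin m),
            (δ / 4) / (((Fintype.card α : ℝ) + 1) ^ m₀ - (Fintype.card α : ℝ) ^ m₀) ≤
              rdens (univ.filter fun y : γ → Option α =>
                ∀ a : α, Sum.elim (U (some ∘ wordLine w a)) y ∈ transport e A)) := by
  classical
  haveI : Nonempty α := Fintype.card_pos_iff.1 (by omega)
  obtain ⟨a₀⟩ := (inferInstance : Nonempty α)
  have hm1 : 1 ≤ m := le_trans hm₀ hm
  -- the Graham–Rothschild dimension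
  obtain ⟨G, hG⟩ := hGR α Bool m hm1
  set M : ℕ := max G 1 with hMdef
  have hM1 : 1 ≤ M := le_max_right _ _
  have hk' : 2 ≤ Fintype.card (Option α) := by rw [Fintype.card_option]; omega
  refine ⟨(⌊(((Fintype.card (Option α) : ℝ)) ^ M - 1) / ε'⌋₊ + 2) * M, fun ι _ _ hι A hA => ?_⟩
  obtain ⟨β, γ, _, _, _, _, e, V, hV⟩ := uniformization hk' hM1 hε' hι A
  set A' : Finset (β ⊕ γ → Option α) := transport e A with hA'
  have hAd : rdens A' = rdens A := rdens_transport e A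
  set θ : ℝ := (δ / 4) / (((Fintype.card α : ℝ) + 1) ^ m₀ - (Fintype.card α : ℝ) ^ m₀) with hθ
  -- the colouring of the lines of `α^{Fin M}`
  set good : Line α (Fin M) → Bool := fun L =>
    decide (θ ≤ rdens (univ.filter fun y : γ → Option α => ∀ a : α, Sum.elim (V (some ∘ L a)) y ∈ A'))
    with hgood
  obtain ⟨Y, c, hYc⟩ := hG (Fin M) (by simp [hMdef]) good
  set U : Subspace (Fin m) (Option α) β := Subspace.comp V (Subspace.mapLetters some Y) with hU
  have hUa : ∀ u : Fin m → Option α, δ - ε' ≤ rdens (fiber A' (U u)) := by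
    intro u
    rw [hU, Subspace.comp_apply]
    have := hV (Subspace.mapLetters some Y u)
    rw [hA'] at this ⊢
    linarith
  -- case analysis on the common colour
  cases c with
  | true =>
    refine ⟨β, γ, inferInstance, inferInstance, inferInstance, inferInstance, e, U, hUa, ?_⟩
    intro w hw
    obtain ⟨e₀, he₀⟩ := mem_lineWords.1 hw
    set L : Line α (Fin m) := ⟨w, ⟨e₀, he₀⟩⟩ with hL
    have hc := hYc L
    simp only [hgood, decide_eq_true_eq] at hc
    have heq : ∀ a, U (some ∘ wordLine w a) = V (some ∘ (Subspace.line Y L) a) := by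
      intro a
      rw [hU, Subspace.comp_apply, ← line_apply_eq_wordLine L, Subspace.mapLetters_apply,
        Subspace.line_apply]
    simp only [heq]
    exact hc
  | false =>
    exfalso
    -- the `m₀`-dimensional subspace `Z = Y ∘ first` of `α^{Fin M}` and its points in `V`
    set Z : Subspace (Fin m₀) α (Fin M) := Subspace.comp Y (Subspace.first m₀ m hm a₀) with hZ
    set p : (Fin m₀ → α) → (β → Option α) := fun z => V (some ∘ Z z) with hp
    have hpd : ∀ z, δ / 2 ≤ rdens (fiber A' (p z)) := by
      intro z
      have := hV (some ∘ Z z)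
      rw [hA'] at this ⊢
      linarith
    -- count pairs `(z, y)` with `p z ⌢ y ∈ A'`
    have hKγ : (0 : ℝ) < Fintype.card (γ → Option α) := by exact_mod_cast card_cube_pos
    have hKz : (0 : ℝ) < Fintype.card (Fin m₀ → α) := by exact_mod_cast card_cube_pos
    set S : (γ → Option α) → Finset (Fin m₀ → α) := fun y => univ.filter fun z => Sum.elim (p z) y ∈ A'
      with hS
    have hswap : ∑ z : Fin m₀ → α, (#(fiber A' (p z)) : ℝ) = ∑ y : γ → Option α, (#(S y) : ℝ) := by
      have : ∑ z : Fin m₀ → α, #(fiber A' (p z)) = ∑ y : γ → Option α, #(S y) := by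
        simp only [fiber, hS, card_filter]; exact sum_comm
      exact_mod_cast this
    have hsum : δ / 2 * #(univ : Finset (γ → Option α)) ≤
        ∑ y : γ → Option α, (#(S y) : ℝ) / Fintype.card (Fin m₀ → α) := by
      rw [← sum_div, ← hswap, le_div_iff₀ hKz, card_univ]
      calc δ / 2 * (Fintype.card (γ → Option α) : ℝ) * Fintype.card (Fin m₀ → α)
          = ∑ _z : Fin m₀ → α, δ / 2 * (Fintype.card (γ → Option α) : ℝ) := by
            rw [sum_const, card_univ, nsmul_eq_mul]; ring
        _ ≤ ∑ z : Fin m₀ → α, (#(fiber A' (p z)) : ℝ) := sum_le_sum fun z _ => by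
            rw [card_eq_rdens_mul]; exact mul_le_mul_of_nonneg_right (hpd z) hKγ.le
    -- the dense set `B` of good `y`
    set B : Finset (γ → Option α) := univ.filter fun y => δ / 4 ≤ (#(S y) : ℝ) / Fintype.card (Fin m₀ → α)
      with hB
    have hBcard : δ / 4 * Fintype.card (γ → Option α) ≤ #B := by
      have := le_card_filter_of_le_sum univ (fun y => (#(S y) : ℝ) / Fintype.card (Fin m₀ → α))
        (fun y _ => by rw [div_le_one hKz]; exact_mod_cast card_le_univ _) (by positivity : (0:ℝ) ≤ δ / 4) hsum
      rw [card_univ] at this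
      convert this using 1; ring
    -- a line in each `S y`, `y ∈ B`, and the most popular one
    have hline : ∀ y ∈ B, ∃ l : Line α (Fin m₀), ∀ a, l a ∈ S y := by
      intro y hy
      refine hDHJ (Fin m₀) (by simp) (S y) ?_
      rw [rdens_def]; exact (mem_filter.1 hy).2
    let f : (γ → Option α) → (Fin m₀ → Option α) := fun y =>
      if hy : y ∈ B then (Classical.choose (hline y hy)).idxFun else fun _ => none
    obtain ⟨w₀, hw₀mem, hw₀⟩ := exists_le_card_fiber_real B (lineWords α (Fin m₀))
      (lineWords_nonempty α hm₀) f (by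
        intro y hy
        simp only [f, dif_pos hy]
        exact idxFun_mem_lineWords _)
    set C : Finset (γ → Option α) := B.filter fun y => f y = w₀ with hC
    have hW : (0 : ℝ) < ((Fintype.card α : ℝ) + 1) ^ m₀ - (Fintype.card α : ℝ) ^ m₀ := by
      rw [← card_lineWords_real]; exact_mod_cast (lineWords_nonempty α hm₀).card_pos
    have hCcard : θ * Fintype.card (γ → Option α) ≤ #C := by
      rw [card_lineWords_real] at hw₀
      calc θ * Fintype.card (γ → Option α)
          = δ / 4 * Fintype.card (γ → Option α) / (((Fintype.card α : ℝ) + 1) ^ m₀ - (Fintype.card α : ℝ) ^ m₀) := by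
            rw [hθ]; ring
        _ ≤ #B / (((Fintype.card α : ℝ) + 1) ^ m₀ - (Fintype.card α : ℝ) ^ m₀) := by gcongr
        _ ≤ #C := hw₀
    have hθpos : 0 < θ := by rw [hθ]; positivity
    have hCne : C.Nonempty := by
      rw [← card_pos]
      have : (0 : ℝ) < #C := lt_of_lt_of_le (by positivity) hCcard
      exact_mod_cast this
    obtain ⟨y₀, hy₀⟩ := hCne
    have hy₀B : y₀ ∈ B := (mem_filter.1 hy₀).1
    set l₀ : Line α (Fin m₀) := Classical.choose (hline y₀ hy₀B) with hl₀
    have hl₀w : l₀.idxFun = w₀ := by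
      have := (mem_filter.1 hy₀).2
      simp only [f, dif_pos hy₀B] at this
      exact this
    have hl₀C : ∀ y ∈ C, ∀ a, Sum.elim (p (l₀ a)) y ∈ A' := by
      intro y hy a
      have hyB : y ∈ B := (mem_filter.1 hy).1
      have hfy : f y = w₀ := (mem_filter.1 hy).2
      simp only [f, dif_pos hyB] at hfy
      have heq : Classical.choose (hline y hyB) = l₀ := Line.ext (by rw [hfy, hl₀w])
      have := Classical.choose_spec (hline y hyB) a
      rw [heq] at this
      exact (mem_filter.1 this).2
    -- the line `first ∘ l₀` of `Y` is good: contradiction with the colour `false`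
    set L : Line α (Fin m) := Subspace.line (Subspace.first m₀ m hm a₀) l₀ with hL
    have hc := hYc L
    simp only [hgood, decide_eq_false_iff_not, not_le] at hc
    have hpt : ∀ a, V (some ∘ (Subspace.line Y L) a) = p (l₀ a) := by
      intro a
      rw [hp, hZ, hL, ← Subspace.comp_line, Subspace.line_apply]
    simp only [hpt] at hc
    have hCsub : C ⊆ univ.filter fun y : γ → Option α => ∀ a : α, Sum.elim (p (l₀ a)) y ∈ A' := by
      intro y hy
      exact mem_filter.2 ⟨mem_univ _, hl₀C y hy⟩
    have : θ ≤ rdens (univ.filter fun y : γ → Option α => ∀ a : α, Sum.elim (p (l₀ a)) y ∈ A') := by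
      rw [rdens_def, le_div_iff₀ hKγ]
      exact hCcard.trans (by exact_mod_cast card_le_card hCsub)
    linarith


/-! ### DKT Lemma 8 -/

/-- The density of `A` inside the subspace `W` (identifying `W` with `(Option α)^m`):
`dens_W(A) = #{x : W(x) ∈ A} / (k+1)^m`. [cite: DodosKanellopoulosTyros2014, Section 2] -/
noncomputable def densIn {α ι : Type*} [Fintype α] [DecidableEq α] [Fintype ι] {m : ℕ}
    (W : Subspace (Fin m) (Option α) ι) (A : Finset (ι → Option α)) : ℝ :=
  rdens (univ.filter fun x : Fin m → Option α => W x ∈ A)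

/-- Pulling a subspace of `β ⊕ γ` back to `ι` along `e : ι ≃ β ⊕ γ`: membership in `A` becomes
membership in `transport e A`. [folklore] -/
theorem subspaceReindex_symm_mem {η α ι ι' : Type*} (W : Subspace η α ι') (e : ι ≃ ι')
    (A : Finset (ι → α)) (x : η → α) :
    ⇑(subspaceReindex W e.symm) x ∈ A ↔ W x ∈ transport e A := by
  rw [subspaceReindex_apply, Equiv.symm_symm, mem_transport]

/-- **DKT Lemma 8.** In the setting of Lemma 7 (`DHJ α` with witness `m₀` at density `δ/4`,
Graham–Rothschild, `k = |α| ≥ 2`, `m ≥ m₀`, `θ = (δ/4)/((k+1)^{m₀} - k^{m₀})`) let `0 < η ≤ 1` with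
`η < θ/2` and `η² ≤ δ`. Then for all large `ι` and every `A ⊆ (Option α)^ι` of density `≥ δ`:
either some `m`-dimensional subspace `X` has `dens_X(A) ≥ δ + η²/2`, or there is an
`m`-dimensional subspace `W` with `dens_W(A) ≥ δ - 2η` and at least `(θ/2) · #lines` of the lines
`ℓ` of `W ↾ k` contained in `A`. [cite: DodosKanellopoulosTyros2014, Lemma 8] -/
theorem dkt_lemma8 {α : Type} [Fintype α] [DecidableEq α] (hk : 1 ≤ Fintype.card α)
    (hGR : GrahamRothschildLines) {δ : ℝ} (hδ : 0 < δ) {m₀ : ℕ} (hm₀ : 1 ≤ m₀)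
    (hDHJ : ∀ (ι : Type) [Fintype ι] [DecidableEq ι], m₀ ≤ Fintype.card ι →
      ∀ B : Finset (ι → α), δ / 4 ≤ rdens B → ∃ l : Line α ι, ∀ a, l a ∈ B)
    {m : ℕ} (hm : m₀ ≤ m) {η : ℝ} (hη : 0 < η) (hη1 : η ≤ 1) (hηδ : η ^ 2 ≤ δ)
    (hηθ : η < (δ / 4) / (((Fintype.card α : ℝ) + 1) ^ m₀ - (Fintype.card α : ℝ) ^ m₀) / 2) :
    ∃ N : ℕ, ∀ (ι : Type) [Fintype ι] [DecidableEq ι], N ≤ Fintype.card ι →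
      ∀ A : Finset (ι → Option α), δ ≤ rdens A →
        (∃ X : Subspace (Fin m) (Option α) ι, δ + η ^ 2 / 2 ≤ densIn X A) ∨
        (∃ W : Subspace (Fin m) (Option α) ι, δ - 2 * η ≤ densIn W A ∧
          (δ / 4) / (((Fintype.card α : ℝ) + 1) ^ m₀ - (Fintype.card α : ℝ) ^ m₀) / 2 *
              #(lineWords α (Fin m)) ≤
            #((lineWords α (Fin m)).filter fun w => ∀ a : α, W (some ∘ wordLine w a) ∈ A)) := by
  classical
  haveI : Nonempty α := Fintype.card_pos_iff.1 (by omega)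
  set θ : ℝ := (δ / 4) / (((Fintype.card α : ℝ) + 1) ^ m₀ - (Fintype.card α : ℝ) ^ m₀) with hθ
  have hε' : 0 < η ^ 2 / 2 := by positivity
  have hε'δ : η ^ 2 / 2 ≤ δ / 2 := by linarith
  obtain ⟨N, hN⟩ := dkt_lemma7 hk hGR hδ hm₀ hDHJ hm hε' hε'δ
  refine ⟨N, fun ι _ _ hι A hA => ?_⟩
  obtain ⟨β, γ, _, _, _, _, e, U, hUa, hUb⟩ := hN ι hι A hA
  set A' : Finset (β ⊕ γ → Option α) := transport e A with hA'
  by_cases hX : ∃ X : Subspace (Fin m) (Option α) ι, δ + η ^ 2 / 2 ≤ densIn X A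
  · exact Or.inl hX
  right
  push Not at hX
  have hKγ : (0 : ℝ) < Fintype.card (γ → Option α) := by exact_mod_cast card_cube_pos
  have hKx : (0 : ℝ) < Fintype.card (Fin m → Option α) := by exact_mod_cast card_cube_pos
  -- `g y = dens_{U ⌢ y}(A)`
  set g : (γ → Option α) → ℝ := fun y =>
    rdens (univ.filter fun x : Fin m → Option α => Sum.elim (U x) y ∈ A') with hg
  have hgX : ∀ y, g y = densIn (subspaceReindex (Subspace.horiz U y) e.symm) A := by
    intro y
    simp only [hg, densIn]
    congr 1
    refine filter_congr fun x _ => ?_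
    rw [subspaceReindex_symm_mem, Subspace.horiz_apply]
  have hglt : ∀ y ∈ (univ : Finset (γ → Option α)), g y ≤ δ + η ^ 2 / 2 := fun y _ => by
    rw [hgX]; exact (hX _).le
  have hgsum : (δ - η ^ 2 / 2) * #(univ : Finset (γ → Option α)) ≤ ∑ y, g y := by
    have hswap : ∑ y : γ → Option α, (#(univ.filter fun x : Fin m → Option α => Sum.elim (U x) y ∈ A') : ℝ)
        = ∑ x : Fin m → Option α, (#(fiber A' (U x)) : ℝ) := by
      have : ∑ y : γ → Option α, #(univ.filter fun x : Fin m → Option α => Sum.elim (U x) y ∈ A')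
          = ∑ x : Fin m → Option α, #(fiber A' (U x)) := by
        simp only [fiber, card_filter]; exact sum_comm
      exact_mod_cast this
    have h1 : ∑ y, g y = (∑ x : Fin m → Option α, (#(fiber A' (U x)) : ℝ)) / Fintype.card (Fin m → Option α) := by
      simp only [hg, rdens_def, ← sum_div, hswap]
    rw [h1, le_div_iff₀ hKx, card_univ]
    calc (δ - η ^ 2 / 2) * (Fintype.card (γ → Option α) : ℝ) * Fintype.card (Fin m → Option α)
        = ∑ _x : Fin m → Option α, (δ - η ^ 2 / 2) * (Fintype.card (γ → Option α) : ℝ) := by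
          rw [sum_const, card_univ, nsmul_eq_mul]; ring
      _ ≤ ∑ x : Fin m → Option α, (#(fiber A' (U x)) : ℝ) := sum_le_sum fun x _ => by
          rw [card_eq_rdens_mul]; exact mul_le_mul_of_nonneg_right (hUa x) hKγ.le
  -- `H₁`: few `y` have `g y < δ - 2η`
  have hH1 := card_filter_lt_mul_le univ g (M := δ + η ^ 2 / 2) (m := δ - η ^ 2 / 2)
    (u := 2 * η - η ^ 2 / 2) hglt hgsum
  have hmu : δ - η ^ 2 / 2 - (2 * η - η ^ 2 / 2) = δ - 2 * η := by ring
  rw [hmu, card_univ] at hH1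
  -- `H₂`: many `y` have `F y ≥ θ/2`
  set F : (γ → Option α) → ℝ := fun y =>
    (#((lineWords α (Fin m)).filter fun w => ∀ a : α, Sum.elim (U (some ∘ wordLine w a)) y ∈ A') : ℝ) /
      #(lineWords α (Fin m)) with hF
  have hLpos : (0 : ℝ) < #(lineWords α (Fin m)) := by
    exact_mod_cast (lineWords_nonempty α (le_trans hm₀ hm)).card_pos
  have hFle : ∀ y ∈ (univ : Finset (γ → Option α)), F y ≤ 1 := fun y _ => by
    rw [hF, div_le_one hLpos]; exact_mod_cast card_le_card (filter_subset _ _)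
  have hFsum : θ * #(univ : Finset (γ → Option α)) ≤ ∑ y, F y := by
    have hswap : ∑ y : γ → Option α,
        (#((lineWords α (Fin m)).filter fun w => ∀ a : α, Sum.elim (U (some ∘ wordLine w a)) y ∈ A') : ℝ)
        = ∑ w ∈ lineWords α (Fin m),
          (#(univ.filter fun y : γ → Option α => ∀ a : α, Sum.elim (U (some ∘ wordLine w a)) y ∈ A') : ℝ) := by
      have : ∑ y : γ → Option α,
          #((lineWords α (Fin m)).filter fun w => ∀ a : α, Sum.elim (U (some ∘ wordLine w a)) y ∈ A')
          = ∑ w ∈ lineWords α (Fin m),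
            #(univ.filter fun y : γ → Option α => ∀ a : α, Sum.elim (U (some ∘ wordLine w a)) y ∈ A') := by
        simp only [card_filter]; exact sum_comm
      exact_mod_cast this
    have h1 : ∑ y, F y = (∑ w ∈ lineWords α (Fin m),
        (#(univ.filter fun y : γ → Option α => ∀ a : α, Sum.elim (U (some ∘ wordLine w a)) y ∈ A') : ℝ)) /
          #(lineWords α (Fin m)) := by
      simp only [hF, ← sum_div, hswap]
    rw [h1, le_div_iff₀ hLpos, card_univ]
    calc θ * (Fintype.card (γ → Option α) : ℝ) * #(lineWords α (Fin m))
        = ∑ _w ∈ lineWords α (Fin m), θ * (Fintype.card (γ → Option α) : ℝ) := by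
          rw [sum_const, nsmul_eq_mul]; ring
      _ ≤ _ := sum_le_sum fun w hw => by
          have := hUb w hw
          rw [rdens_def, le_div_iff₀ hKγ] at this
          exact this
  have hH2 := le_card_filter_of_le_sum univ F hFle (by linarith : (0 : ℝ) ≤ θ / 2) hFsum
  rw [card_univ] at hH2
  -- a common element of `H₁` and `H₂`
  set H1 : Finset (γ → Option α) := univ.filter fun y => ¬ g y < δ - 2 * η with hH1def
  set H2 : Finset (γ → Option α) := univ.filter fun y => θ / 2 ≤ F y with hH2def
  have hH1card : (Fintype.card (γ → Option α) : ℝ) - η * Fintype.card (γ → Option α) ≤ #H1 := by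
    have hsplit : (#(univ.filter fun y : γ → Option α => g y < δ - 2 * η) : ℝ) + #H1
        = Fintype.card (γ → Option α) := by
      rw [hH1def]; exact_mod_cast card_filter_add_card_filter_not (s := univ) (fun y => g y < δ - 2 * η)
    have hu : η ≤ 2 * η - η ^ 2 / 2 := by nlinarith
    have hbad : (#(univ.filter fun y : γ → Option α => g y < δ - 2 * η) : ℝ) * η ≤
        η ^ 2 * Fintype.card (γ → Option α) := by
      calc (#(univ.filter fun y : γ → Option α => g y < δ - 2 * η) : ℝ) * η
          ≤ #(univ.filter fun y : γ → Option α => g y < δ - 2 * η) * (2 * η - η ^ 2 / 2) := by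
            gcongr
        _ ≤ (δ + η ^ 2 / 2 - (δ - η ^ 2 / 2)) * Fintype.card (γ → Option α) := hH1
        _ = η ^ 2 * Fintype.card (γ → Option α) := by ring
    have hbad' : (#(univ.filter fun y : γ → Option α => g y < δ - 2 * η) : ℝ) ≤
        η * Fintype.card (γ → Option α) := by
      have := (mul_le_mul_iff_of_pos_right hη).1 (by rw [sq] at hbad; linarith [hbad] : (#(univ.filter fun y : γ → Option α => g y < δ - 2 * η) : ℝ) * η ≤ η * Fintype.card (γ → Option α) * η)
      exact this
    linarith
  have hH2card : θ / 2 * Fintype.card (γ → Option α) ≤ #H2 := by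
    convert hH2 using 1; ring
  have hinter : (H1 ∩ H2).Nonempty := by
    rw [← card_pos]
    have h1 : #(H1 ∪ H2) ≤ Fintype.card (γ → Option α) := card_le_univ _
    have h2 : (#(H1 ∪ H2) : ℝ) + #(H1 ∩ H2) = #H1 + #H2 := by
      exact_mod_cast card_union_add_card_inter H1 H2
    have h3 : (Fintype.card (γ → Option α) : ℝ) < #H1 + #H2 := by
      have : (0 : ℝ) < (θ / 2 - η) * Fintype.card (γ → Option α) := mul_pos (by linarith) hKγ
      linarith
    have h5 : (#(H1 ∪ H2) : ℝ) ≤ Fintype.card (γ → Option α) := by exact_mod_cast h1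
    have : (0 : ℝ) < #(H1 ∩ H2) := by linarith
    exact_mod_cast this
  obtain ⟨y₀, hy₀⟩ := hinter
  have hy₁ : δ - 2 * η ≤ g y₀ := not_lt.1 (mem_filter.1 (mem_inter.1 hy₀).1).2
  have hy₂ : θ / 2 ≤ F y₀ := (mem_filter.1 (mem_inter.1 hy₀).2).2
  refine ⟨subspaceReindex (Subspace.horiz U y₀) e.symm, ?_, ?_⟩
  · rw [← hgX]; exact hy₁
  · rw [hF, le_div_iff₀ hLpos] at hy₂
    have hset : ((lineWords α (Fin m)).filter fun w => ∀ a : α,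
        ⇑(subspaceReindex (Subspace.horiz U y₀) e.symm) (some ∘ wordLine w a) ∈ A) =
        ((lineWords α (Fin m)).filter fun w => ∀ a : α, Sum.elim (U (some ∘ wordLine w a)) y₀ ∈ A') :=
      filter_congr fun w _ => forall_congr' fun a => by
        rw [subspaceReindex_symm_mem, Subspace.horiz_apply]
    rw [hset]
    exact hy₂




/-! ### Insensitive sets (DKT Definition 9) -/

/-- DKT Def. 9 in the `Option` encoding: `D ⊆ (Option α)^η` is `(i, ∗)`-insensitive (`∗ = none`
the new letter) if membership in `D` is unchanged when letters `i` and `∗` are interchanged at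
will, i.e. depends only on the word `wordLine x i` obtained by reading `∗` as `i`.
[cite: DodosKanellopoulosTyros2014, Definition 9] -/
def Insensitive {α η : Type*} (i : α) (D : Finset (η → Option α)) : Prop :=
  ∀ x y : η → Option α, wordLine x i = wordLine y i → (x ∈ D ↔ y ∈ D)

/-- The whole cube is insensitive. [folklore] -/
theorem insensitive_univ {α η : Type*} [Fintype α] [DecidableEq α] [Fintype η] [DecidableEq η]
    (i : α) : Insensitive i (univ : Finset (η → Option α)) := fun _ _ _ => by simp

/-- Complements of insensitive sets are insensitive. [cite: DodosKanellopoulosTyros2014, Definition 9 (remark)] -/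
theorem Insensitive.compl {α η : Type*} [Fintype α] [DecidableEq α] [Fintype η] [DecidableEq η]
    {i : α} {D : Finset (η → Option α)} (h : Insensitive i D) : Insensitive i Dᶜ :=
  fun x y hxy => by rw [mem_compl, mem_compl, h x y hxy]

/-- Intersections of insensitive sets are insensitive. [cite: DodosKanellopoulosTyros2014, Definition 9 (remark)] -/
theorem Insensitive.inter {α η : Type*} [DecidableEq α] [Fintype η]
    {i : α} {D D' : Finset (η → Option α)} (h : Insensitive i D) (h' : Insensitive i D') :
    Insensitive i (D ∩ D') :=
  fun x y hxy => by rw [mem_inter, mem_inter, h x y hxy, h' x y hxy]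

/-- `wordLine` of a wildcard-free word recovers the word. [folklore] -/
theorem wordLine_some_comp {α η : Type*} (z : η → α) (i : α) : wordLine (some ∘ z) i = z := by
  funext r; simp [wordLine]

/-- Reading `∗` as `i` twice: `wordLine (some ∘ wordLine x i) j = wordLine x i`. [folklore] -/
theorem wordLine_idem {α η : Type*} (x : η → Option α) (i j : α) :
    wordLine (some ∘ wordLine x i) j = wordLine x i := wordLine_some_comp _ _

/-! ### DKT Lemma 10 -/

/-- The trace `A_W = {x : W(x) ∈ A}` of `A` on the subspace `W` (a subset of `(Option α)^m`).
[cite: DodosKanellopoulosTyros2014, Section 2] -/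
def traceIn {α ι : Type*} [Fintype α] [DecidableEq α] [Fintype ι] {m : ℕ}
    (W : Subspace (Fin m) (Option α) ι) (A : Finset (ι → Option α)) : Finset (Fin m → Option α) :=
  univ.filter fun x => W x ∈ A

/-- The structured set `C = ⋂_i C_i`, `C_i = {x : W(x^{∗→i}) ∈ A}` of DKT Lemma 10.
[cite: DodosKanellopoulosTyros2014, Lemma 10 (proof)] -/
def setC {α ι : Type*} [Fintype α] [DecidableEq α] [Fintype ι] {m : ℕ}
    (W : Subspace (Fin m) (Option α) ι) (A : Finset (ι → Option α)) : Finset (Fin m → Option α) :=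
  univ.filter fun x => ∀ i : α, W (some ∘ wordLine x i) ∈ A

/-- The sets `C_i`. [cite: DodosKanellopoulosTyros2014, Lemma 10 (proof)] -/
def setCi {α ι : Type*} [Fintype α] [DecidableEq α] [Fintype ι] {m : ℕ}
    (W : Subspace (Fin m) (Option α) ι) (A : Finset (ι → Option α)) (i : α) : Finset (Fin m → Option α) :=
  univ.filter fun x => W (some ∘ wordLine x i) ∈ A

/-- `C_i` is `(i, ∗)`-insensitive. [cite: DodosKanellopoulosTyros2014, Lemma 10 (a)] -/
theorem insensitive_setCi {α ι : Type*} [Fintype α] [DecidableEq α] [Fintype ι] {m : ℕ}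
    (W : Subspace (Fin m) (Option α) ι) (A : Finset (ι → Option α)) (i : α) :
    Insensitive i (setCi W A i) := fun x y hxy => by
  simp only [setCi, mem_filter, mem_univ, true_and, hxy]

/-- `C = ⋂_i C_i`. [cite: DodosKanellopoulosTyros2014, Lemma 10 (a)] -/
theorem mem_setC_iff {α ι : Type*} [Fintype α] [DecidableEq α] [Fintype ι] {m : ℕ}
    (W : Subspace (Fin m) (Option α) ι) (A : Finset (ι → Option α)) (x : Fin m → Option α) :
    x ∈ setC W A ↔ ∀ i, x ∈ setCi W A i := by
  simp [setC, setCi]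

/-- A word of `(Option α)^m` with a wildcard, read over the alphabet `Option α` with its `none`s
as wildcards, is a line of `(Option α)^m` through `x` (at `∗`) and the `x^{∗→i}` (at `i`).
[cite: DodosKanellopoulosTyros2014, Lemma 10 (b)] -/
def liftLine {α : Type*} {m : ℕ} (x : Fin m → Option α) (hx : ∃ e, x e = none) :
    Line (Option α) (Fin m) where
  idxFun r := (x r).map some
  proper := by obtain ⟨e, he⟩ := hx; exact ⟨e, by simp [he]⟩

/-- `liftLine x (some i) = x^{∗→i}`. [folklore] -/
theorem liftLine_apply_some {α : Type*} {m : ℕ} (x : Fin m → Option α) (hx : ∃ e, x e = none) (i : α) :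
    ⇑(liftLine x hx) (some i) = some ∘ wordLine x i := by
  funext r
  simp only [Line.coe_apply, liftLine, Function.comp_apply, wordLine]
  cases x r <;> simp

/-- `liftLine x ∗ = x`. [folklore] -/
theorem liftLine_apply_none {α : Type*} {m : ℕ} (x : Fin m → Option α) (hx : ∃ e, x e = none) :
    ⇑(liftLine x hx) none = x := by
  funext r
  simp only [Line.coe_apply, liftLine]
  cases x r <;> simp

/-- **DKT Lemma 10.** Let `W` be an `m`-dimensional subspace of `(Option α)^ι` with
`dens_W(A) ≥ δ - 2η` and at least `(θ/2) · #lines` of the lines of `W ↾ k` inside `A`; assume `A`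
contains no combinatorial line, `k^m ≤ η (k+1)^m`, `0 < η`, `0 < θ`, `48 η ≤ δ θ`,
`η ≤ 1/2`. Then `C = ⋂_i C_i` (each `C_i` `(i,∗)`-insensitive in `W`) has `dens_W(C) ≥ θ/4`,
`dens_W(A ∖ C) ≥ δ - 3η` and `dens_W(A ∖ C) ≥ (δ + 6η) dens_W(W ∖ C)`.
[cite: DodosKanellopoulosTyros2014, Lemma 10] -/
theorem dkt_lemma10 {α ι : Type} [Fintype α] [DecidableEq α] [Fintype ι] [DecidableEq ι]
    (hk : 1 ≤ Fintype.card α) {m : ℕ} (W : Subspace (Fin m) (Option α) ι) (A : Finset (ι → Option α))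
    (hfree : ¬ ∃ l : Line (Option α) ι, ∀ a, l a ∈ A) {δ η θ : ℝ} (hη : 0 < η) (hη2 : η ≤ 1 / 2)
    (hθ : 0 < θ) (h48 : 48 * η ≤ δ * θ)
    (hkm : (Fintype.card α : ℝ) ^ m ≤ η * ((Fintype.card α : ℝ) + 1) ^ m)
    (hdens : δ - 2 * η ≤ rdens (traceIn W A))
    (hlines : θ / 2 * #(lineWords α (Fin m)) ≤
      #((lineWords α (Fin m)).filter fun w => ∀ a : α, W (some ∘ wordLine w a) ∈ A)) :
    θ / 4 ≤ rdens (setC W A) ∧ δ - 3 * η ≤ rdens (traceIn W A \ setC W A) ∧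
      (δ + 6 * η) * rdens (univ \ setC W A) ≤ rdens (traceIn W A \ setC W A) := by
  classical
  haveI : Nonempty α := Fintype.card_pos_iff.1 (by omega)
  have hK : (Fintype.card (Fin m → Option α) : ℝ) = ((Fintype.card α : ℝ) + 1) ^ m := by
    rw [Fintype.card_fun, Fintype.card_option, Fintype.card_fin]; push_cast; ring
  have hKpos : (0 : ℝ) < Fintype.card (Fin m → Option α) := by exact_mod_cast card_cube_pos
  -- (a): `B ⊆ C`
  have hBC : ((lineWords α (Fin m)).filter fun w => ∀ a : α, W (some ∘ wordLine w a) ∈ A) ⊆ setC W A := by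
    intro w hw
    exact mem_filter.2 ⟨mem_univ _, (mem_filter.1 hw).2⟩
  have hCcard : θ / 4 * Fintype.card (Fin m → Option α) ≤ #(setC W A) := by
    have h1 : (#(setC W A) : ℝ) ≥ θ / 2 * #(lineWords α (Fin m)) :=
      hlines.trans (by exact_mod_cast card_le_card hBC)
    rw [card_lineWords_real] at h1
    rw [hK]
    nlinarith [pow_nonneg (Nat.cast_nonneg (Fintype.card α) : (0:ℝ) ≤ _) m]
  have ha : θ / 4 ≤ rdens (setC W A) := by
    rw [rdens_def, le_div_iff₀ hKpos]; exact hCcard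
  -- (b): `A_W ∩ C` consists of wildcard-free words
  have hAC : traceIn W A ∩ setC W A ⊆ univ.filter fun x : Fin m → Option α => ¬ ∃ e, x e = none := by
    intro x hx
    rw [mem_inter] at hx
    refine mem_filter.2 ⟨mem_univ _, fun hnone => hfree ?_⟩
    refine ⟨Subspace.line W (liftLine x hnone), fun a => ?_⟩
    rw [Subspace.line_apply]
    cases a with
    | none => rw [liftLine_apply_none]; exact (mem_filter.1 hx.1).2
    | some i => rw [liftLine_apply_some]; exact (mem_filter.1 hx.2).2 i
  have hACcard : (#(traceIn W A ∩ setC W A) : ℝ) ≤ η * Fintype.card (Fin m → Option α) := by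
    have h1 : #(traceIn W A ∩ setC W A) ≤ #(univ.filter fun x : Fin m → Option α => ¬ ∃ e, x e = none) :=
      card_le_card hAC
    have h2 : #(univ.filter fun x : Fin m → Option α => ¬ ∃ e, x e = none) + #(lineWords α (Fin m)) =
        Fintype.card (Fin m → Option α) := by
      rw [lineWords, add_comm, card_filter_add_card_filter_not, card_univ]
    have h3 : (#(univ.filter fun x : Fin m → Option α => ¬ ∃ e, x e = none) : ℝ) = (Fintype.card α : ℝ) ^ m := by
      have := card_lineWords_real α m
      have h2' : (#(univ.filter fun x : Fin m → Option α => ¬ ∃ e, x e = none) : ℝ) + #(lineWords α (Fin m)) =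
          Fintype.card (Fin m → Option α) := by exact_mod_cast h2
      rw [hK] at h2'; linarith
    calc (#(traceIn W A ∩ setC W A) : ℝ) ≤ (Fintype.card α : ℝ) ^ m := by rw [← h3]; exact_mod_cast h1
      _ ≤ η * Fintype.card (Fin m → Option α) := by rw [hK]; exact hkm
  have hb2 : δ - 3 * η ≤ rdens (traceIn W A \ setC W A) := by
    have h1 : (#(traceIn W A \ setC W A) : ℝ) = #(traceIn W A) - #(traceIn W A ∩ setC W A) := by
      have := card_inter_add_card_sdiff (traceIn W A) (setC W A)
      have h' : (#(traceIn W A ∩ setC W A) : ℝ) + #(traceIn W A \ setC W A) = #(traceIn W A) := by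
        exact_mod_cast this
      linarith
    rw [rdens_def, le_div_iff₀ hKpos, h1]
    rw [rdens_def, le_div_iff₀ hKpos] at hdens
    linarith
  refine ⟨ha, hb2, ?_⟩
  -- the ratio form
  have hQC : rdens (univ \ setC W A) ≤ 1 - θ / 4 := by
    have : rdens (univ \ setC W A) = 1 - rdens (setC W A) := by
      rw [← compl_eq_univ_sdiff, rdens_compl]
    rw [this]; linarith
  have hQCnn : 0 ≤ rdens (univ \ setC W A) := rdens_nonneg _
  calc (δ + 6 * η) * rdens (univ \ setC W A) ≤ (δ + 6 * η) * (1 - θ / 4) := by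
        have : 0 ≤ δ + 6 * η := by nlinarith
        exact mul_le_mul_of_nonneg_left hQC this
    _ ≤ δ - 3 * η := by nlinarith
    _ ≤ rdens (traceIn W A \ setC W A) := hb2


/-! ### DKT Corollary 11 -/

/-- Selection step in DKT Cor. 11: if nonnegative `a_j ≤ λ_j` (`j < k`) satisfy
`∑ a_j ≥ (δ + 6η) ∑ λ_j` and `∑ λ_j > 0`... in the form: there is `j₀` with
`λ_{j₀} ≥ (3η/k) ∑ λ_j` and `a_{j₀} ≥ (δ + 3η) λ_{j₀}`. [cite: DodosKanellopoulosTyros2014, Corollary 11 (proof)] -/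
theorem exists_good_index {k : ℕ} (lam a : Fin k → ℝ) (hlam : ∀ j, 0 ≤ lam j)
    (ha : ∀ j, a j ≤ lam j) {δ η : ℝ} (hη : 0 < η) (hδη : 0 ≤ δ + 3 * η)
    (hsum : (δ + 6 * η) * ∑ j, lam j ≤ ∑ j, a j) (hpos : 0 < ∑ j, lam j) :
    ∃ j₀, 3 * η / k * ∑ j, lam j ≤ lam j₀ ∧ (δ + 3 * η) * lam j₀ ≤ a j₀ := by
  classical
  set J : Finset (Fin k) := univ.filter fun j => (δ + 3 * η) * lam j ≤ a j with hJ
  have hsplit_a := sum_filter_add_sum_filter_not univ (fun j => (δ + 3 * η) * lam j ≤ a j) a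
  have hsplit_l := sum_filter_add_sum_filter_not univ (fun j => (δ + 3 * η) * lam j ≤ a j) lam
  have hbad : ∑ j ∈ univ.filter (fun j => ¬ (δ + 3 * η) * lam j ≤ a j), a j ≤
      (δ + 3 * η) * ∑ j ∈ univ.filter (fun j => ¬ (δ + 3 * η) * lam j ≤ a j), lam j := by
    rw [mul_sum]
    exact sum_le_sum fun j hj => (not_le.1 (mem_filter.1 hj).2).le
  have hgood_le : ∑ j ∈ J, a j ≤ ∑ j ∈ J, lam j := sum_le_sum fun j _ => ha j
  have hJsum : 3 * η * ∑ j, lam j ≤ ∑ j ∈ J, lam j := by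
    have hnn : 0 ≤ ∑ j ∈ J, lam j := sum_nonneg fun j _ => hlam j
    nlinarith [hsplit_a, hsplit_l, hbad, hgood_le, hsum]
  have hJne : J.Nonempty := by
    rw [nonempty_iff_ne_empty]; intro hJe
    rw [hJe, sum_empty] at hJsum
    nlinarith
  obtain ⟨j₀, hj₀J, hj₀⟩ : ∃ j₀ ∈ J, (∑ j ∈ J, lam j) / #J ≤ lam j₀ := by
    refine exists_le_of_sum_le hJne ?_
    rw [sum_const, nsmul_eq_mul, mul_div_cancel₀ _ (by exact_mod_cast hJne.card_pos.ne')]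
  refine ⟨j₀, ?_, (mem_filter.1 hj₀J).2⟩
  have hJk : (#J : ℝ) ≤ k := by
    have : #J ≤ Fintype.card (Fin k) := card_le_univ J
    rw [Fintype.card_fin] at this; exact_mod_cast this
  have hJpos : (0 : ℝ) < #J := by exact_mod_cast hJne.card_pos
  calc 3 * η / k * ∑ j, lam j ≤ 3 * η / #J * ∑ j, lam j := by gcongr
    _ = (3 * η * ∑ j, lam j) / #J := by ring
    _ ≤ (∑ j ∈ J, lam j) / #J := by gcongr
    _ ≤ lam j₀ := hj₀

/-- Numerical inequality for Cor. 11: `γ = δη²/(2k) ≤ η²/2`. [folklore] -/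
theorem cor11_num1 {δ η k : ℝ} (hη : 0 < η) (hδ1 : δ ≤ 1) (hk : 1 ≤ k) :
    δ * η ^ 2 / (2 * k) ≤ η ^ 2 / 2 := by
  rw [div_le_div_iff₀ (by positivity) (by norm_num : (0:ℝ) < 2)]
  have : 0 < η ^ 2 := by positivity
  nlinarith

/-- Numerical inequality for Cor. 11: `γ ≤ (3η/k)(δ - 3η)`. [folklore] -/
theorem cor11_num2 {δ η k : ℝ} (hη : 0 < η) (hη2 : η ≤ 1 / 2) (hη48 : 48 * η ≤ δ) (hδ1 : δ ≤ 1)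
    (hk : 1 ≤ k) : δ * η ^ 2 / (2 * k) ≤ 3 * η / k * (δ - 3 * η) := by
  have hkpos : 0 < k := by linarith
  rw [div_mul_eq_mul_div, div_le_div_iff₀ (by positivity) hkpos]
  have hlin : 0 ≤ 3 * δ - 9 * η - δ * η := by nlinarith
  have h1 : δ * η ^ 2 ≤ 3 * η * (δ - 3 * η) := by nlinarith [mul_nonneg hη.le hlin]
  have h2 : 0 ≤ 3 * η * (δ - 3 * η) := by nlinarith
  nlinarith [mul_le_mul_of_nonneg_right h1 hkpos.le, mul_nonneg h2 hkpos.le]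

/-- **DKT Corollary 11.** In the setting of Lemmas 7–10 (`DHJ α` witnessed by `m₀` at density
`δ/4`, Graham–Rothschild, `k = |α| ≥ 2`, `m ≥ m₀`, `θ = (δ/4)/((k+1)^{m₀} - k^{m₀})`,
`η` with `48η ≤ δθ`, `η < θ/2`, `η ≤ 1/2`, `η² ≤ δ`, `k^m ≤ η (k+1)^m`, `δ ≤ 1`): for all large `ι`,
if `A ⊆ (Option α)^ι` has density `≥ δ` and contains no combinatorial line, then there are an
`m`-dimensional subspace `W` and sets `D_i` (`i ∈ α`), `D_i` `(i,∗)`-insensitive in `W`, such that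
`D = ⋂ D_i` has `dens_W(D) ≥ γ` and `dens_W(A ∩ D) ≥ (δ + γ) dens_W(D)`; here `γ = δ η² / (2k)` (DKT
take `δ η²/k` for `k ≥ 2`; the extra factor `2` makes the statement hold for `k ≥ 1` as well).
[cite: DodosKanellopoulosTyros2014, Corollary 11] -/
theorem dkt_cor11 {α : Type} [Fintype α] [DecidableEq α] (hk : 1 ≤ Fintype.card α)
    (hGR : GrahamRothschildLines) {δ : ℝ} (hδ : 0 < δ) (hδ1 : δ ≤ 1) {m₀ : ℕ} (hm₀ : 1 ≤ m₀)
    (hDHJ : ∀ (ι : Type) [Fintype ι] [DecidableEq ι], m₀ ≤ Fintype.card ι →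
      ∀ B : Finset (ι → α), δ / 4 ≤ rdens B → ∃ l : Line α ι, ∀ a, l a ∈ B)
    {m : ℕ} (hm : m₀ ≤ m) {η : ℝ} (hη : 0 < η) (hη2 : η ≤ 1 / 2) (hηδ : η ^ 2 ≤ δ)
    (hθ1 : (δ / 4) / (((Fintype.card α : ℝ) + 1) ^ m₀ - (Fintype.card α : ℝ) ^ m₀) ≤ 1)
    (h48 : 48 * η ≤ δ * ((δ / 4) / (((Fintype.card α : ℝ) + 1) ^ m₀ - (Fintype.card α : ℝ) ^ m₀)))
    (hηθ : η < (δ / 4) / (((Fintype.card α : ℝ) + 1) ^ m₀ - (Fintype.card α : ℝ) ^ m₀) / 2)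
    (hkm : (Fintype.card α : ℝ) ^ m ≤ η * ((Fintype.card α : ℝ) + 1) ^ m) :
    ∃ N : ℕ, ∀ (ι : Type) [Fintype ι] [DecidableEq ι], N ≤ Fintype.card ι →
      ∀ A : Finset (ι → Option α), δ ≤ rdens A → (¬ ∃ l : Line (Option α) ι, ∀ a, l a ∈ A) →
        ∃ (W : Subspace (Fin m) (Option α) ι) (D : α → Finset (Fin m → Option α)),
          (∀ i, Insensitive i (D i)) ∧
          δ * η ^ 2 / (2 * Fintype.card α) ≤ rdens (univ.filter fun x => ∀ i, x ∈ D i) ∧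
          (δ + δ * η ^ 2 / (2 * Fintype.card α)) * rdens (univ.filter fun x => ∀ i, x ∈ D i) ≤
            rdens (traceIn W A ∩ univ.filter fun x => ∀ i, x ∈ D i) := by
  classical
  haveI : Nonempty α := Fintype.card_pos_iff.1 (by omega)
  set k : ℕ := Fintype.card α with hkdef
  set θ : ℝ := (δ / 4) / ((((k : ℝ)) + 1) ^ m₀ - (k : ℝ) ^ m₀) with hθdef
  have hθpos : 0 < θ := by linarith
  set γ : ℝ := δ * η ^ 2 / (2 * k) with hγ
  have hkpos : (0 : ℝ) < k := by rw [hkdef]; exact_mod_cast (by omega : 0 < Fintype.card α)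
  have hk1 : (1 : ℝ) ≤ k := by rw [hkdef]; exact_mod_cast hk
  have hγη : γ ≤ η ^ 2 / 2 := cor11_num1 hη hδ1 hk1
  have hη48 : 48 * η ≤ δ := h48.trans (mul_le_of_le_one_right hδ.le hθ1)
  have hγ3η : γ ≤ 3 * η := hγη.trans (by nlinarith)
  obtain ⟨N, hN⟩ := dkt_lemma8 hk hGR hδ hm₀ hDHJ hm hη (by linarith) hηδ hηθ
  refine ⟨N, fun ι _ _ hι A hA hfree => ?_⟩
  have hKpos : (0 : ℝ) < Fintype.card (Fin m → Option α) := by exact_mod_cast card_cube_pos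
  rcases hN ι hι A hA with ⟨X, hX⟩ | ⟨W, hWd, hWl⟩
  · -- density increment already: trivial structured set
    refine ⟨X, fun _ => univ, fun i => insensitive_univ i, ?_, ?_⟩
    · have : (univ.filter fun x : Fin m → Option α => ∀ i : α, x ∈ (univ : Finset (Fin m → Option α))) = univ := by
        ext x; simp
      rw [this, rdens_univ]
      calc γ ≤ η ^ 2 / 2 := hγη
        _ ≤ 1 := by nlinarith
    · have h1 : (univ.filter fun x : Fin m → Option α => ∀ i : α, x ∈ (univ : Finset (Fin m → Option α))) = univ := by
        ext x; simp
      rw [h1, rdens_univ, mul_one, inter_univ]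
      have : densIn X A = rdens (traceIn X A) := rfl
      linarith
  · -- Lemma 10 and the selection of `i₀`
    obtain ⟨hCa, hCb, hCc⟩ := dkt_lemma10 hk W A hfree hη hη2 hθpos h48 hkm hWd hWl
    set σ : Fin k ≃ α := (Fintype.equivFin α).symm with hσ
    set Cj : Fin k → Finset (Fin m → Option α) := fun j => setCi W A (σ j) with hCj
    set P : Fin k → Finset (Fin m → Option α) := fun j =>
      univ.filter fun x => x ∉ Cj j ∧ ∀ j' < j, x ∈ Cj j' with hP
    -- `P` partitions `univ \ C`
    have hCmem : ∀ x, x ∈ setC W A ↔ ∀ j, x ∈ Cj j := by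
      intro x
      rw [mem_setC_iff]
      constructor
      · intro h j; exact h (σ j)
      · intro h i; have := h (σ.symm i); simpa [hCj] using this
    have hPdisj : ∀ j₁ j₂, j₁ ≠ j₂ → Disjoint (P j₁) (P j₂) := by
      intro j₁ j₂ hne
      rw [disjoint_left]
      intro x h1 h2
      rw [hP, mem_filter] at h1 h2
      rcases lt_or_gt_of_ne hne with h | h
      · exact h1.2.1 (h2.2.2 j₁ h)
      · exact h2.2.1 (h1.2.2 j₂ h)
    have hPunion : (univ : Finset (Fin k)).biUnion P = univ \ setC W A := by
      ext x
      simp only [mem_biUnion, mem_univ, true_and, mem_sdiff, hCmem]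
      constructor
      · rintro ⟨j, hj⟩
        rw [hP, mem_filter] at hj
        exact fun h => hj.2.1 (h j)
      · intro h
        push Not at h
        -- the least `j` with `x ∉ Cj j`
        obtain ⟨j, hj⟩ := h
        have hex : ∃ j : Fin k, x ∉ Cj j := ⟨j, hj⟩
        let P' : ℕ → Prop := fun n => ∃ j : Fin k, (j : ℕ) = n ∧ x ∉ Cj j
        have hP' : ∃ n, P' n := ⟨j, j, rfl, hj⟩
        set n₀ := Nat.find hP' with hn₀
        obtain ⟨j₀, hj₀n, hj₀⟩ := Nat.find_spec hP'
        refine ⟨j₀, ?_⟩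
        rw [hP, mem_filter]
        refine ⟨mem_univ _, hj₀, fun j' hj' => ?_⟩
        by_contra hcon
        have : P' j' := ⟨j', rfl, hcon⟩
        have hmin := Nat.find_min hP' (m := j') (by
          have : (j' : ℕ) < j₀ := hj'
          rw [hj₀n] at this; exact this)
        exact hmin this
    set lam : Fin k → ℝ := fun j => rdens (P j) with hlam
    set a : Fin k → ℝ := fun j => rdens (traceIn W A ∩ P j) with ha
    have hlam_sum : ∑ j, lam j = rdens (univ \ setC W A) := by
      simp only [hlam, rdens_def, ← sum_div]
      congr 1
      rw [← hPunion, card_biUnion (fun j₁ _ j₂ _ hne => hPdisj j₁ j₂ hne)]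
      push_cast; rfl
    have ha_sum : ∑ j, a j = rdens (traceIn W A \ setC W A) := by
      simp only [ha, rdens_def, ← sum_div]
      congr 1
      have hdisj' : ∀ j₁ ∈ (univ : Finset (Fin k)), ∀ j₂ ∈ (univ : Finset (Fin k)), j₁ ≠ j₂ →
          Disjoint (traceIn W A ∩ P j₁) (traceIn W A ∩ P j₂) := fun j₁ _ j₂ _ hne =>
        (hPdisj j₁ j₂ hne).mono inter_subset_right inter_subset_right
      have : traceIn W A \ setC W A = (univ : Finset (Fin k)).biUnion fun j => traceIn W A ∩ P j := by
        rw [← inter_biUnion, hPunion]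
        ext x; simp [mem_sdiff, mem_inter]
      rw [this, card_biUnion hdisj']
      push_cast; rfl
    have hΛT : rdens (traceIn W A \ setC W A) ≤ rdens (univ \ setC W A) :=
      rdens_mono (sdiff_subset_sdiff (subset_univ _) le_rfl)
    have hηδ' : 3 * η < δ := by linarith
    have hpos : 0 < ∑ j, lam j := by rw [hlam_sum]; linarith
    obtain ⟨j₀, hj₀l, hj₀a⟩ := exists_good_index (k := k) lam a
      (fun j => rdens_nonneg _) (fun j => rdens_mono inter_subset_right) (δ := δ) (η := η) hη
      (by linarith) (by rw [hlam_sum, ha_sum]; exact hCc) hpos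
    -- the structured set
    let D : α → Finset (Fin m → Option α) := fun i =>
      if (σ.symm i : ℕ) < j₀ then Cj (σ.symm i) else if σ.symm i = j₀ then (Cj j₀)ᶜ else univ
    have hCjσ : ∀ i, Cj (σ.symm i) = setCi W A i := fun i => by simp [hCj]
    have hDins : ∀ i, Insensitive i (D i) := by
      intro i
      simp only [D]
      split_ifs with h1 h2
      · rw [hCjσ]; exact insensitive_setCi W A i
      · have e2 : Cj j₀ = setCi W A i := by rw [← hCjσ i, h2]
        rw [e2]; exact (insensitive_setCi W A i).compl
      · exact insensitive_univ i
    have hDcap : (univ.filter fun x : Fin m → Option α => ∀ i, x ∈ D i) = P j₀ := by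
      ext x
      simp only [mem_filter, mem_univ, true_and, hP]
      constructor
      · intro h
        refine ⟨?_, fun j' hj' => ?_⟩
        · have := h (σ j₀)
          simp only [D, Equiv.symm_apply_apply, lt_irrefl, if_false, if_true, mem_compl] at this
          exact this
        · have := h (σ j')
          simp only [D, Equiv.symm_apply_apply] at this
          rwa [if_pos (show ((j' : ℕ)) < j₀ from hj')] at this
      · rintro ⟨hx₀, hx⟩ i
        simp only [D]
        split_ifs with h1 h2
        · exact hx _ h1
        · rw [mem_compl]; exact hx₀
        · exact mem_univ _
    refine ⟨W, D, hDins, ?_, ?_⟩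
    · rw [hDcap]
      change γ ≤ lam j₀
      calc γ ≤ 3 * η / k * (δ - 3 * η) := cor11_num2 hη hη2 hη48 hδ1 hk1
        _ ≤ 3 * η / k * ∑ j, lam j := by
            apply mul_le_mul_of_nonneg_left _ (by positivity)
            rw [hlam_sum]; linarith
        _ ≤ lam j₀ := hj₀l
    · rw [hDcap]
      change (δ + γ) * lam j₀ ≤ rdens (traceIn W A ∩ P j₀)
      calc (δ + γ) * lam j₀ ≤ (δ + 3 * η) * lam j₀ := by
            apply mul_le_mul_of_nonneg_right _ (rdens_nonneg _); linarith
        _ ≤ a j₀ := hj₀a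


end Literature.Combinatorics.HalesJewett
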